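import Literature.NumberTheory.FaltingsSerre.ResidualRigidity
import Literature.NumberTheory.FaltingsSerre.ResidualRigidityS3wrS2
import Literature.NumberTheory.FaltingsSerre.SymplecticLift
import HarnessLib

/-!
# The Faltings–Serre method after Brumer–Pacetti–Poor–Tornaría–Voight–Yuen:
# `residual_eq` and `similitude₂` of the certificate schema FROM ROUTE-T FIELD DATA — the one-stop
# theorems the certificate producers instantiate (images `S₅(b)`, `S₆`, `S₃ ≀ S₂`)

[BPPTVY] = A. Brumer, A. Pacetti, C. Poor, G. Tornaría, J. Voight, D. S. Yuen, *On the paramodularity of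
typical abelian surfaces*, Algebra & Number Theory **13**:5 (2019) 1145–1195 [cite: BrumerEtAl2019].

## What this file supplies (typer unit `pub-paramod`, DIVERGENCE.md D-20/D-22)

Step 1 of the method ([BPPTVY, §2.3 p. 1149]: "Conjugating `ρ₂`, we may assume `ρ₁ ≡ ρ₂ (mod ℓ)`, and we
write `ρ̄ := ρ̄₁ = ρ̄₂`"; for `N = 277`: [BPPTVY, proof of Thm. 7.1.3 with Lemma 7.1.4, p. 1187–1188]; for
`N = 587`: [BPPTVY, §7.3 p. 1190–1191]) packaged for continuous framed representations
`ρ₁, ρ₂ : G →ₜ* GL₄(ℤ₂)` (`Literature.NumberTheory.GaloisRepresentations.FramedRep`), by composing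

* the residual RIGIDITY theorems of `Literature.NumberTheory.FaltingsSerre.ResidualRigidity`
  (`exists_conj_of_ker_iff_of_range_S5b`, `…_of_transvection`, `…_of_trace_orderThree`, and — from
  `Literature.NumberTheory.FaltingsSerre.ResidualRigidityS3wrS2` — `…_of_range_S3wrS2` for `N = 353`: same
  `2`-division field + compatible symplectic images ⇒ `ρ̄₂ = ι(π) ρ̄₁ ι(π)⁻¹`), with
* the symplectic RE-FRAMING theorem of `Literature.NumberTheory.FaltingsSerre.SymplecticLift`
  (`exists_symplectic_reframe_framed`: lift `ι(π)⁻¹` to `P ∈ Sp(J)(ℤ₂)`, `J = antiIdAlt4 ℤ_[2]`).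

Output, in each of the four cases: an explicit `P ∈ GL₄(ℤ₂)` with `Pᵀ J P = J` such that the re-framed
`ρ₂' := FramedRep.conj P ρ₂ = P ρ₂ P⁻¹` satisfies LITERALLY
`residual ρ₂'.toMonoidHom = residual ρ₁.toMonoidHom` (the field `residual_eq` of
`Literature.NumberTheory.FaltingsSerre.Paramodular.Certificate`, up to the symmetric orientation) and
inherits every `IsSimilitude J c (ρ₂ γ)` (the field `similitude₂`, same multiplier).  The remaining
schema fields of `ρ₂'` (continuity, unramifiedness, traces, Frobenius characteristic polynomials) are
conjugation-invariant.  Everything is PROVED; nothing here is a cited fact.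

## References
* [BPPTVY] ANT 13:5 (2019): §2.3 p. 1149; (5.1.2), Lemma 5.1.7 with (5.1.8) p. 1173–1174; Lemma 7.1.4
  p. 1188; §7.3 p. 1190–1191. [cite: BrumerEtAl2019]
-/

namespace Literature.NumberTheory.FaltingsSerre.GSp4F2

open Matrix Equiv Equiv.Perm
open Literature.NumberTheory.GaloisRepresentations (IsSimilitude FramedRep)
open Literature.NumberTheory.FaltingsSerre (residual)

variable {G : Type*} [Group G] [TopologicalSpace G]

/-- **Route-T form (images `S₆` or `S₅(b)`)**: if `ρ̄₁, ρ̄₂ : G → GL₄(𝔽₂)` are symplectic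
(`⊆ ι(S₆) = Sp₄(𝔽₂)`), have the same kernel (= cut out the same `2`-division field), `ρ̄₁(c)` has order
`5` for some `c`, and at ONE common element `i` both `ρ̄₁(i)` and `ρ̄₂(i)` are transvections, then after a
symplectic change of frame of `ρ₂` the residual representations are EQUAL and the similitude data of
`ρ₂` are kept [BPPTVY, Lemma 7.1.4 p. 1188 (277), §7.3 p. 1190 (587), §2.3 p. 1149 (re-framing)].
[cite: BrumerEtAl2019, Lemma 7.1.4 p. 1188, §7.3 p. 1190 and §2.3 p. 1149] -/
theorem exists_reframe_of_transvection (ρ₁ ρ₂ : FramedRep G ℤ_[2] 4)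
    (hSp₁ : (residual ρ₁.toMonoidHom).range ≤ iotaGL.range)
    (hSp₂ : (residual ρ₂.toMonoidHom).range ≤ iotaGL.range)
    (hker : ∀ γ, residual ρ₁.toMonoidHom γ = 1 ↔ residual ρ₂.toMonoidHom γ = 1)
    {c : G} (hc5 : residual ρ₁.toMonoidHom c ^ 5 = 1) (hc1 : residual ρ₁.toMonoidHom c ≠ 1)
    {i : G}
    (hi₁ : IsTransvection ((residual ρ₁.toMonoidHom i : GL (Fin 4) (ZMod 2)) :
      Matrix (Fin 4) (Fin 4) (ZMod 2)))
    (hi₂ : IsTransvection ((residual ρ₂.toMonoidHom i : GL (Fin 4) (ZMod 2)) :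
      Matrix (Fin 4) (Fin 4) (ZMod 2))) :
    ∃ P : GL (Fin 4) ℤ_[2], IsSimilitude (antiIdAlt4 ℤ_[2]) 1 (P : Matrix (Fin 4) (Fin 4) ℤ_[2]) ∧
      residual (FramedRep.conj P ρ₂).toMonoidHom = residual ρ₁.toMonoidHom ∧
      ∀ (γ : G) (c : ℤ_[2]),
        IsSimilitude (antiIdAlt4 ℤ_[2]) c ((ρ₂ γ : GL (Fin 4) ℤ_[2]) : Matrix (Fin 4) (Fin 4) ℤ_[2]) →
        IsSimilitude (antiIdAlt4 ℤ_[2]) c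
          ((FramedRep.conj P ρ₂ γ : GL (Fin 4) ℤ_[2]) : Matrix (Fin 4) (Fin 4) ℤ_[2]) := by
  obtain ⟨π, hπ⟩ :=
    exists_conj_of_ker_iff_of_transvection _ _ hSp₁ hSp₂ hker hc5 hc1 hi₁ hi₂
  exact exists_symplectic_reframe_framed ρ₁ ρ₂ π hπ

/-- **Image `S₅(b)` with no Frobenius datum**: if both residual images are point stabilisers
`ι(Stab(x)) ≅ S₅(b)` and the kernels agree, a symplectic change of frame of `ρ₂` makes the residual
representations EQUAL and keeps the similitude data [BPPTVY, Lemma 7.1.4 p. 1188; §2.3 p. 1149].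
[cite: BrumerEtAl2019, Lemma 7.1.4 p. 1188 and §2.3 p. 1149] -/
theorem exists_reframe_of_range_S5b (ρ₁ ρ₂ : FramedRep G ℤ_[2] 4) {x₁ x₂ : Fin 6}
    (h₁ : (residual ρ₁.toMonoidHom).range = (MulAction.stabilizer (Perm (Fin 6)) x₁).map iotaGL)
    (h₂ : (residual ρ₂.toMonoidHom).range = (MulAction.stabilizer (Perm (Fin 6)) x₂).map iotaGL)
    (hker : ∀ γ, residual ρ₁.toMonoidHom γ = 1 ↔ residual ρ₂.toMonoidHom γ = 1) :
    ∃ P : GL (Fin 4) ℤ_[2], IsSimilitude (antiIdAlt4 ℤ_[2]) 1 (P : Matrix (Fin 4) (Fin 4) ℤ_[2]) ∧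
      residual (FramedRep.conj P ρ₂).toMonoidHom = residual ρ₁.toMonoidHom ∧
      ∀ (γ : G) (c : ℤ_[2]),
        IsSimilitude (antiIdAlt4 ℤ_[2]) c ((ρ₂ γ : GL (Fin 4) ℤ_[2]) : Matrix (Fin 4) (Fin 4) ℤ_[2]) →
        IsSimilitude (antiIdAlt4 ℤ_[2]) c
          ((FramedRep.conj P ρ₂ γ : GL (Fin 4) ℤ_[2]) : Matrix (Fin 4) (Fin 4) ℤ_[2]) := by
  obtain ⟨π, hπ⟩ := exists_conj_of_ker_iff_of_range_S5b _ _ h₁ h₂ hker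
  exact exists_symplectic_reframe_framed ρ₁ ρ₂ π hπ

/-- **Printed `587` form (image `S₆`, (5.1.8))**: if `ρ̄₁` is onto `Sp₄(𝔽₂)`, `ρ̄₂` is symplectic, the
kernels agree, and the traces of `ρ̄₁(u)`, `ρ̄₂(u)` agree at ONE element `u` with `ρ̄₁(u)` of order
`3`, a symplectic change of frame of `ρ₂` makes the residual representations EQUAL and keeps the
similitude data [BPPTVY, §7.3 p. 1190–1191 with Lemma 5.1.7/(5.1.8) p. 1174; §2.3 p. 1149].
[cite: BrumerEtAl2019, §7.3 p. 1190, (5.1.8) p. 1174 and §2.3 p. 1149] -/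
theorem exists_reframe_of_trace_orderThree (ρ₁ ρ₂ : FramedRep G ℤ_[2] 4)
    (h₁ : (residual ρ₁.toMonoidHom).range = iotaGL.range)
    (hSp₂ : (residual ρ₂.toMonoidHom).range ≤ iotaGL.range)
    (hker : ∀ γ, residual ρ₁.toMonoidHom γ = 1 ↔ residual ρ₂.toMonoidHom γ = 1)
    {u : G} (hu3 : residual ρ₁.toMonoidHom u ^ 3 = 1) (hu1 : residual ρ₁.toMonoidHom u ≠ 1)
    (htr : Matrix.trace ((residual ρ₁.toMonoidHom u : GL (Fin 4) (ZMod 2)) :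
        Matrix (Fin 4) (Fin 4) (ZMod 2)) =
      Matrix.trace ((residual ρ₂.toMonoidHom u : GL (Fin 4) (ZMod 2)) :
        Matrix (Fin 4) (Fin 4) (ZMod 2))) :
    ∃ P : GL (Fin 4) ℤ_[2], IsSimilitude (antiIdAlt4 ℤ_[2]) 1 (P : Matrix (Fin 4) (Fin 4) ℤ_[2]) ∧
      residual (FramedRep.conj P ρ₂).toMonoidHom = residual ρ₁.toMonoidHom ∧
      ∀ (γ : G) (c : ℤ_[2]),
        IsSimilitude (antiIdAlt4 ℤ_[2]) c ((ρ₂ γ : GL (Fin 4) ℤ_[2]) : Matrix (Fin 4) (Fin 4) ℤ_[2]) →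
        IsSimilitude (antiIdAlt4 ℤ_[2]) c
          ((FramedRep.conj P ρ₂ γ : GL (Fin 4) ℤ_[2]) : Matrix (Fin 4) (Fin 4) ℤ_[2]) := by
  obtain ⟨π, hπ⟩ := exists_conj_of_ker_iff_of_trace_orderThree _ _ h₁ hSp₂ hker hu3 hu1 htr
  exact exists_symplectic_reframe_framed ρ₁ ρ₂ π hπ

/-- **Image `S₃ ≀ S₂` (`N = 353`, [BPPTVY, §7.2])**: if `ρ̄₁` has image a conjugate of
`ι(S₃ ≀ S₂)`, `ρ̄₂` is symplectic, the kernels agree, and the traces of `ρ̄₁(u)`, `ρ̄₂(u)` agree at ONE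
element `u` with `ρ̄₁(u)` of order `3` or `6` (this kills the outer class of `Aut(S₃ ≀ S₂)`, which flips
the (5.1.8)-trace of every such element), a symplectic change of frame of `ρ₂` makes the residual
representations EQUAL and keeps the similitude data [BPPTVY, §7.2 p. 1190; (5.1.8) p. 1174; §2.3 p. 1149].
[cite: BrumerEtAl2019, §7.2 p. 1190, (5.1.8) p. 1174 and §2.3 p. 1149] -/
theorem exists_reframe_of_range_S3wrS2 (ρ₁ ρ₂ : FramedRep G ℤ_[2] 4)
    (h₁ : ∃ g₁ : Perm (Fin 6), (residual ρ₁.toMonoidHom).range =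
      ((Subgroup.closure (Set.range gensS3wrS2)).map (MulAut.conj g₁).toMonoidHom).map iotaGL)
    (hSp₂ : (residual ρ₂.toMonoidHom).range ≤ iotaGL.range)
    (hker : ∀ γ, residual ρ₁.toMonoidHom γ = 1 ↔ residual ρ₂.toMonoidHom γ = 1)
    {u : G} (hu6 : residual ρ₁.toMonoidHom u ^ 6 = 1) (hu2 : residual ρ₁.toMonoidHom u ^ 2 ≠ 1)
    (htr : Matrix.trace ((residual ρ₁.toMonoidHom u : GL (Fin 4) (ZMod 2)) :
        Matrix (Fin 4) (Fin 4) (ZMod 2)) =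
      Matrix.trace ((residual ρ₂.toMonoidHom u : GL (Fin 4) (ZMod 2)) :
        Matrix (Fin 4) (Fin 4) (ZMod 2))) :
    ∃ P : GL (Fin 4) ℤ_[2], IsSimilitude (antiIdAlt4 ℤ_[2]) 1 (P : Matrix (Fin 4) (Fin 4) ℤ_[2]) ∧
      residual (FramedRep.conj P ρ₂).toMonoidHom = residual ρ₁.toMonoidHom ∧
      ∀ (γ : G) (c : ℤ_[2]),
        IsSimilitude (antiIdAlt4 ℤ_[2]) c ((ρ₂ γ : GL (Fin 4) ℤ_[2]) : Matrix (Fin 4) (Fin 4) ℤ_[2]) →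
        IsSimilitude (antiIdAlt4 ℤ_[2]) c
          ((FramedRep.conj P ρ₂ γ : GL (Fin 4) ℤ_[2]) : Matrix (Fin 4) (Fin 4) ℤ_[2]) := by
  obtain ⟨π, hπ⟩ := exists_conj_of_ker_iff_of_range_S3wrS2 _ _ h₁ hSp₂ hker hu6 hu2 htr
  exact exists_symplectic_reframe_framed ρ₁ ρ₂ π hπ

end Literature.NumberTheory.FaltingsSerre.GSp4F2
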